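import Literature.Algebra.EuclideanLattices.LLL
import Literature.Algebra.EuclideanLattices.IntegerBases
import Literature.Algebra.EuclideanLattices.Encoding
import Literature.Computability.Complexity.TimeBounds
import Mathlib.Analysis.SpecialFunctions.Log.Basic
import HarnessLib

/-!
# The LLL basis reduction algorithm (LLL82, Fig. 1) and the architecture of its analysis

Trunk: Lattice (`Literature/Algebra/EuclideanLattices`), companion of `LLL.lean` (the predicate
`Literature.Algebra.EuclideanLattices.IsLLLReduced`) and of `PQCLLL.lean` (the named fact `Literature.Algebra.EuclideanLattices.lll_polyTime`, LLL82
Prop. 1.26 in `Turing.TM2ComputableInPolyTime` form). This file formalises the *algorithm* of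
A. K. Lenstra, H. W. Lenstra Jr., L. Lovász, *Factoring polynomials with rational coefficients*,
Math. Ann. 261 (1982) 515–534 (LLL82), §1, Fig. 1, as a pure function, and vendors the
intermediate results of the proof of LLL82 Prop. 1.26 (polynomial running time) as named facts,
so that `lll_polyTime` can be assembled bottom-up (D-0014: Literature is sorry-free; facts are
`def … : Prop` discharged later by `theorem …_holds`). The printed proof is followed in the
numbered form of M. R. Bremner, *Lattice Basis Reduction* (CRC 2011), Ch. 4 (Fig. 4.1 = LLL82
Fig. 1; Lemmas 4.11–4.18, Thm. 4.19, Thms. 4.22–4.23), cf. H. Cohen, *A Course in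
Computational Algebraic Number Theory* (1993), Algorithm 2.6.3 and pp. 134–135.

## The algorithm (LLL82 Fig. 1 / Bremner Fig. 4.1), as a step function

The vectors `b₀, …, bₙ₋₁` live in an additive group `V` (for LLL82: `V = ℤᵐ`) and are measured
through an additive map `φ : V →+ E` into a real inner product space (for LLL82: the inclusion
`ℤᵐ ↪ ℝᵐ`, `Literature.Algebra.EuclideanLattices.intVecToEuclidean`); all decisions use the Gram–Schmidt data
`μᵢⱼ = gsCoeff (φ ∘ b) i j`, `b*ᵢ = gramSchmidt ℝ (φ ∘ b) i` of `LLL.lean`/Mathlib, all updates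
are integer row operations in `V`, so integer input stays integer by construction. Indices are
`0`-based (`k` below is LLL82's `k - 1`).

* `lllSizeReduce φ b k l` — procedure `reduce(k, l)` (LLL82 Fig. 1 (∗)): if `|μₖₗ| > 1/2`,
  replace `bₖ` by `bₖ - r • bₗ`, `r` the integer nearest to `μₖₗ`.
* `lllSizeReduceBelow φ b k` — `reduce(k, l)` for `l = k-2, k-3, …, 0` in this order
  (`lllSizeReduceFrom φ k a _ b`: the same from `l = a-1` down to `0`).
* `LLLState n V` — the current family and the current index `k : ℕ`; the state is *halted* when
  `n ≤ k` (LLL82: "if `k = n + 1`, terminate"); the start state is `⟨b, 1⟩` (LLL82: `k := 2`).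
* `lllStep φ δ` — one pass through label (1) of LLL82 Fig. 1 (one iteration of the while loop of
  Bremner Fig. 4.1 (4)): `reduce(k, k-1)`; if the Lovász test
  `δ ‖b*ₖ₋₁‖² ≤ ‖b*ₖ + μₖ,ₖ₋₁ b*ₖ₋₁‖²` holds then `reduce(k, k-2), …, reduce(k, 0)` and
  `k := k + 1`, else exchange `bₖ₋₁, bₖ` and `k := max(1, k-1)`. Halted states are fixed; the
  junk state `k = 0` (unreachable from the start state) is sent to `k = 1`.
* `lllResult φ δ b` — the family at the first halted iterate of `lllStep φ δ` from `⟨b, 1⟩`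
  (junk value `b` if no iterate is halted, which the termination fact excludes for lattice bases).
* `LatticeInstance.lllReduce I` — LLL82's algorithm with `δ = 3/4` on an integer basis matrix
  (rows), the candidate witness for `Literature.Algebra.EuclideanLattices.lll_polyTime`.

LLL82 keeps the numbers `μᵢⱼ`, `Bᵢ = ‖b*ᵢ‖²` in a table and updates them incrementally; this
is an implementation of the same function (Bremner Lemmas 4.11–4.12 are exactly the statements
that the table updates agree with recomputation) and matters for the operation count
`O(n⁴ log B)`, not for polynomiality.

## Named facts (the decomposition of LLL82 Prop. 1.26; proofs in later `…Proofs` files)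

* `lllStep_span_eq` (proved here): a pass preserves the subgroup generated by the family
  (row operations `bₖ ← bₖ - r bₗ`, `r ∈ ℤ`, and transpositions are unimodular).
* `isLLLReduced_of_halted` (fact; LLL82 §1 text after Fig. 1, Bremner Lemma 4.13): a halted
  iterate of the start state carries a family that is LLL-reduced with parameter `δ` (the loop
  invariant: `|μᵢⱼ| ≤ 1/2` for `j < i < k` and the Lovász condition below `k`).
* `lll_halts_within` (fact; LLL82 proof of Prop. 1.26, first half; Bremner Lemmas 4.14–4.18 and
  Thm. 4.19): for linearly independent integer vectors with `‖bᵢ‖² ≤ B`, `1/4 < δ < 1`, the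
  iterate number `(n - 1) + 2⌊(n(n-1)/2) · log B / log(1/δ)⌋` is halted (the potential
  `D = ∏_{i<n} dᵢ ∈ ℤ_{>0}`, `dᵢ = ∏_{j≤i} ‖b*ⱼ‖² ≤ Bⁱ`, loses a factor `< δ` at each exchange).
* `lll_norm_sq_le` (fact; LLL82 proof of Prop. 1.26, second half; Bremner Thm. 4.23 (4.6)):
  along the run all vectors satisfy `‖bᵢ‖² ≤ n² (4B)ⁿ`, whence all integers met have binary
  length `O(n log B)`.
* `lllReduce_polyTime` (fact; LLL82 Prop. 1.26 as printed: `O(n⁴ log B)` arithmetic operations on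
  integers of binary length `O(n log B)`, read through the standard simulation of arithmetic by
  Turing machines, Arora–Barak 2009 §1.3): some `Literature.Computability.Complexity.PolyTimeComputable` function
  (for the encoding `LatticeInstance.encode`) agrees with `LatticeInstance.lllReduce` on every
  nonsingular instance (LLL82's algorithm is only run on bases; what a machine does on singular
  inputs is left open, exactly as in `Literature.Algebra.EuclideanLattices.lll_polyTime`). Its discharge is a stack program
  (`Literature/Computability/Complexity/StackPrograms.lean`, `Com.mem_FP`; arithmetic from
  `StackArith.lean`) running the loop above for the budget of `lll_halts_within` (any larger
  budget computes the same family, halted states being fixed points) on registers of the size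
  given by `lll_norm_sq_le`.

`PQCLLLProofs.lean` assembles `Literature.Algebra.EuclideanLattices.lll_polyTime` from `isLLLReduced_of_halted`,
`lll_halts_within`, `lllReduce_polyTime` and the proved `lllStep_span_eq`.

## Design choices

* Generic `φ : V →+ E` instead of two copies (real families / integer matrices): the integer
  case is `V = Fin m → ℤ`, `φ = intVecToEuclidean m`; the real case is `φ = AddMonoidHom.id E`.
* Nearest integer = Mathlib `round` (ties upward); LLL82 leaves ties unspecified, Bremner's Maple
  code rounds ties downward — immaterial for every statement here (`|μ - round μ| ≤ 1/2`).
* `k : ℕ` rather than `Fin (n + 2)`: halting is `n ≤ k`, no casts in the step function.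
* The Lovász test is the real inequality of `Literature.Algebra.EuclideanLattices.LovaszCondition` verbatim (classical
  `if`); LLL82's equivalent table form `Bₖ ≥ (δ - μ²ₖ,ₖ₋₁) Bₖ₋₁` is Bremner Fig. 4.1 (4)(b).
* `lllResult` uses `Nat.find` on the first halted iterate (halted states are fixed points, so any
  later iterate gives the same family); no iteration budget is built into the definition, the
  budget is the content of the fact `lll_halts_within`.

## References

* A. K. Lenstra, H. W. Lenstra Jr., L. Lovász, Math. Ann. 261 (1982), §1, Fig. 1, Prop. 1.26.
* M. R. Bremner, *Lattice Basis Reduction*, CRC Press 2011, Ch. 4.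
* H. Cohen, *A Course in Computational Algebraic Number Theory*, GTM 138, 1993, §2.6.
* P. Q. Nguyen, *Hermite's constant and lattice algorithms*, in Nguyen–Vallée (eds.),
  *The LLL Algorithm*, Springer 2010, Thm. 10.
-/

noncomputable section

open InnerProductSpace Function

namespace Literature.Algebra.EuclideanLattices

section Algorithm

variable {E : Type*} [NormedAddCommGroup E] [InnerProductSpace ℝ E]
variable {V : Type*} [AddCommGroup V] (φ : V →+ E) {n : ℕ}

/-- Procedure `reduce(k, l)` of the LLL algorithm: if `|μₖₗ| > 1/2` (Gram–Schmidt coefficient of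
the measured family `φ ∘ b`), replace `bₖ` by `bₖ - r • bₗ` with `r = round μₖₗ` the nearest
integer; otherwise do nothing. Intended for `l < k`.
[cite: LenstraLenstraLovasz1982, §1 Fig. 1 (∗)] [cite: Bremner2011, Fig. 4.1 reduce(k,l)] -/
def lllSizeReduce (b : Fin n → V) (k l : Fin n) : Fin n → V :=
  if |gsCoeff (φ ∘ b) k l| ≤ 1 / 2 then b
  else update b k (b k - round (gsCoeff (φ ∘ b) k l) • b l)

/-- The loop `reduce(k, a-1); reduce(k, a-2); …; reduce(k, 0)` (descending), by recursion on
`a`. [cite: LenstraLenstraLovasz1982, §1 Fig. 1] [cite: Bremner2011, Fig. 4.1 (4)(b)(i)] -/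
def lllSizeReduceFrom (k : Fin n) : (a : ℕ) → a ≤ n → (Fin n → V) → (Fin n → V)
  | 0, _, b => b
  | a + 1, h, b => lllSizeReduceFrom k a (Nat.le_of_succ_le h) (lllSizeReduce φ b k ⟨a, h⟩)

/-- The size-reduction loop `reduce(k, l)` for `l = k-2, k-3, …, 0`, in this (descending) order
(LLL82 Fig. 1: "perform (∗) for `l = k-2, …, 1`", `1`-based).
[cite: LenstraLenstraLovasz1982, §1 Fig. 1] [cite: Bremner2011, Fig. 4.1 (4)(b)(i)] -/
def lllSizeReduceBelow (b : Fin n → V) (k : Fin n) : Fin n → V :=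
  lllSizeReduceFrom φ k (k.val - 1) (by omega) b

/-- A state of the LLL algorithm: the current family `b₀, …, bₙ₋₁` and the current index `k`
(`0`-based: `b₀, …, bₖ₋₁` is the part already LLL-reduced; LLL82's index is `k + 1`). The state
is halted when `n ≤ k`. [cite: LenstraLenstraLovasz1982, §1 Fig. 1] -/
structure LLLState (n : ℕ) (V : Type*) where
  /-- the current family of vectors -/
  b : Fin n → V
  /-- the current index (`n ≤ k` means: terminated) -/
  k : ℕ

/-- The Lovász test with parameter `δ` at the indices `(j, k)` of a family `b` in a real inner
product space: `δ ‖b*ⱼ‖² ≤ ‖b*ₖ + μₖⱼ b*ⱼ‖²`; for `j = k - 1` this is the `k`-th clause of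
`Literature.Lattice.LovaszCondition δ b` verbatim. [cite: LenstraLenstraLovasz1982, (1.5)] -/
def LovaszTestAt (δ : ℝ) (b : Fin n → E) (j k : Fin n) : Prop :=
  δ * ‖gramSchmidt ℝ b j‖ ^ 2 ≤ ‖gramSchmidt ℝ b k + gsCoeff b k j • gramSchmidt ℝ b j‖ ^ 2

/-- `LovaszCondition δ b` is the conjunction of the Lovász tests at all consecutive indices
(definitional unfolding). [cite: LenstraLenstraLovasz1982, (1.5)] -/
theorem lovaszCondition_iff_lovaszTestAt (δ : ℝ) (b : Fin n → E) :
    LovaszCondition δ b ↔ ∀ (i : Fin n) (h : (i : ℕ) + 1 < n), LovaszTestAt δ b i ⟨i + 1, h⟩ :=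
  Iff.rfl

open Classical in
/-- One pass of the LLL algorithm with parameter `δ` through label (1) of LLL82 Fig. 1 (one
iteration of the while loop (4) of Bremner Fig. 4.1), for a current index `0 < k < n`:
`reduce(k, k-1)`; then, if the Lovász condition `δ ‖b*ₖ₋₁‖² ≤ ‖b*ₖ + μₖ,ₖ₋₁ b*ₖ₋₁‖²` holds,
`reduce(k, l)` for `l = k-2, …, 0` and `k := k + 1`; otherwise exchange `bₖ₋₁` and `bₖ` and
`k := max(1, k-1)`. A halted state (`n ≤ k`) is left fixed; the junk state `k = 0 < n` becomes
`k = 1`. (The Lovász test is a real inequality: classical `if`.)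
[cite: LenstraLenstraLovasz1982, §1 Fig. 1] [cite: Bremner2011, Fig. 4.1 (4)] -/
def lllStep (δ : ℝ) (s : LLLState n V) : LLLState n V :=
  if hk : 0 < s.k ∧ s.k < n then
    let k : Fin n := ⟨s.k, hk.2⟩
    let j : Fin n := ⟨s.k - 1, by omega⟩
    let b₁ := lllSizeReduce φ s.b k j
    if LovaszTestAt δ (⇑φ ∘ b₁) j k then ⟨lllSizeReduceBelow φ b₁ k, s.k + 1⟩
    else ⟨b₁ ∘ Equiv.swap j k, max 1 (s.k - 1)⟩
  else if s.k < n then ⟨s.b, 1⟩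
  else s

/-- The start state of LLL82 Fig. 1: the input family with `k = 1` (`0`-based; LLL82: `k := 2`).
[cite: LenstraLenstraLovasz1982, §1 Fig. 1] -/
def lllStart (b : Fin n → V) : LLLState n V := ⟨b, 1⟩

/-- The output of the LLL algorithm with parameter `δ` on the family `b`: the family carried by
the first halted iterate `(lllStep φ δ)^[t] (lllStart b)` (halted states are fixed points, so
every later iterate carries the same family). Junk value `b` if no iterate is halted (excluded
for linearly independent integer vectors by `lll_halts_within`).
[cite: LenstraLenstraLovasz1982, §1 Fig. 1 ("terminate")] [cite: Bremner2011, Fig. 4.1] -/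
def lllResult (δ : ℝ) (b : Fin n → V) : Fin n → V := by
  classical
  exact if h : ∃ t, n ≤ ((lllStep φ δ)^[t] (lllStart b)).k then
    ((lllStep φ δ)^[Nat.find h] (lllStart b)).b else b

/-! ### Basic API: halted states are fixed points -/

/-- A halted state (`n ≤ k`) is a fixed point of `lllStep`. [folklore] -/
theorem lllStep_of_le {δ : ℝ} {s : LLLState n V} (h : n ≤ s.k) : lllStep φ δ s = s := by
  unfold lllStep
  rw [dif_neg (by omega), if_neg (by omega)]

/-- Hence all further iterates of a halted state are equal to it. [folklore] -/
theorem iterate_lllStep_of_le {δ : ℝ} {s : LLLState n V} (h : n ≤ s.k) (t : ℕ) :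
    (lllStep φ δ)^[t] s = s :=
  iterate_fixed (lllStep_of_le φ h) t

/-- The index never drops below `1` after a pass (for `n ≠ 0`). [folklore] -/
theorem one_le_lllStep_k {δ : ℝ} (s : LLLState n V) (hn : 0 < n) : 1 ≤ (lllStep φ δ s).k := by
  unfold lllStep
  by_cases hk : 0 < s.k ∧ s.k < n
  · rw [dif_pos hk]
    dsimp only
    split <;> dsimp only <;> omega
  · rw [dif_neg hk]
    split <;> (try dsimp only) <;> omega

/-- The index increases by at most one in a pass. [folklore] -/
theorem lllStep_k_le {δ : ℝ} (s : LLLState n V) : (lllStep φ δ s).k ≤ s.k + 1 := by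
  unfold lllStep
  by_cases hk : 0 < s.k ∧ s.k < n
  · rw [dif_pos hk]
    dsimp only
    split <;> dsimp only <;> omega
  · rw [dif_neg hk]
    split <;> (try dsimp only) <;> omega

/-- If the iterate at time `t` is halted, every later iterate equals it. [folklore] -/
theorem iterate_lllStep_eq_of_halted {δ : ℝ} {s : LLLState n V} {t t' : ℕ} (ht : t ≤ t')
    (h : n ≤ ((lllStep φ δ)^[t] s).k) : (lllStep φ δ)^[t'] s = (lllStep φ δ)^[t] s := by
  obtain ⟨d, rfl⟩ := Nat.exists_eq_add_of_le ht
  rw [add_comm, iterate_add_apply, iterate_lllStep_of_le φ h]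

/-- If some iterate at time `t` is halted, `lllResult` is the family it carries (independently
of `t`). [folklore] -/
theorem lllResult_eq_of_halted {δ : ℝ} {b : Fin n → V} {t : ℕ}
    (h : n ≤ ((lllStep φ δ)^[t] (lllStart b)).k) :
    lllResult φ δ b = ((lllStep φ δ)^[t] (lllStart b)).b := by
  classical
  have hex : ∃ t, n ≤ ((lllStep φ δ)^[t] (lllStart b)).k := ⟨t, h⟩
  unfold lllResult
  rw [dif_pos hex]
  have hmin : Nat.find hex ≤ t := Nat.find_min' hex h
  rw [iterate_lllStep_eq_of_halted φ hmin (Nat.find_spec hex)]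

/-- For `n ≤ 1` the start state is already halted and the algorithm returns its input.
[folklore] -/
theorem lllResult_of_le_one {δ : ℝ} (hn : n ≤ 1) (b : Fin n → V) : lllResult φ δ b = b :=
  lllResult_eq_of_halted φ (t := 0) (by simpa [lllStart] using hn)

/-! ### The lattice is preserved (proved) -/

/-- Replacing `bₖ` by `bₖ - r • bₗ` (`l ≠ k`, `r ∈ ℤ`) does not change the subgroup generated by
the family. [folklore] -/
theorem span_range_update_sub_zsmul (b : Fin n → V) {k l : Fin n} (hkl : l ≠ k) (r : ℤ) :
    Submodule.span ℤ (Set.range (update b k (b k - r • b l))) =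
      Submodule.span ℤ (Set.range b) := by
  apply le_antisymm
  · refine Submodule.span_le.2 ?_
    rintro _ ⟨i, rfl⟩
    by_cases hi : i = k
    · subst hi
      rw [update_self]
      exact Submodule.sub_mem _ (Submodule.subset_span ⟨i, rfl⟩)
        (Submodule.smul_mem _ _ (Submodule.subset_span ⟨l, rfl⟩))
    · rw [update_of_ne hi]
      exact Submodule.subset_span ⟨i, rfl⟩
  · refine Submodule.span_le.2 ?_
    rintro _ ⟨i, rfl⟩
    by_cases hi : i = k
    · subst hi
      have hk : update b i (b i - r • b l) i = b i - r • b l := update_self ..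
      have hl : update b i (b i - r • b l) l = b l := update_of_ne hkl ..
      have hmem : update b i (b i - r • b l) i + r • update b i (b i - r • b l) l ∈
          Submodule.span ℤ (Set.range (update b i (b i - r • b l))) :=
        Submodule.add_mem _ (Submodule.subset_span ⟨i, rfl⟩)
          (Submodule.smul_mem _ _ (Submodule.subset_span ⟨l, rfl⟩))
      rwa [hk, hl, sub_add_cancel] at hmem
    · rw [← update_of_ne hi (b k - r • b l) b]
      exact Submodule.subset_span ⟨i, rfl⟩

/-- `reduce(k, l)` with `l ≠ k` preserves the generated subgroup. [cite: Bremner2011, §4.2 ("always form a basis for the lattice")] -/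
theorem span_range_lllSizeReduce (b : Fin n → V) {k l : Fin n} (hkl : l ≠ k) :
    Submodule.span ℤ (Set.range (lllSizeReduce φ b k l)) = Submodule.span ℤ (Set.range b) := by
  unfold lllSizeReduce
  split_ifs
  · rfl
  · exact span_range_update_sub_zsmul b hkl _

/-- The descending size-reduction loop below `a ≤ k` preserves the generated subgroup. [cite: Bremner2011, §4.2] -/
theorem span_range_lllSizeReduceFrom (k : Fin n) :
    ∀ (a : ℕ) (ha : a ≤ n) (_ : a ≤ k.val) (b : Fin n → V),
      Submodule.span ℤ (Set.range (lllSizeReduceFrom φ k a ha b)) =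
        Submodule.span ℤ (Set.range b)
  | 0, _, _, _ => rfl
  | a + 1, ha, hak, b => by
    rw [lllSizeReduceFrom, span_range_lllSizeReduceFrom k a _ (by omega),
      span_range_lllSizeReduce]
    exact fun h => by have := congrArg Fin.val h; simp only at this; omega

/-- The size-reduction loop preserves the generated subgroup. [cite: Bremner2011, §4.2] -/
theorem span_range_lllSizeReduceBelow (b : Fin n → V) (k : Fin n) :
    Submodule.span ℤ (Set.range (lllSizeReduceBelow φ b k)) = Submodule.span ℤ (Set.range b) :=
  span_range_lllSizeReduceFrom φ k _ _ (by omega) b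

/-- **One pass of the LLL algorithm preserves the lattice**: the subgroup of `V` generated by
the family is invariant under `lllStep` (row operations `bₖ ← bₖ - r bₗ` with `r ∈ ℤ` and
transpositions are unimodular). [cite: LenstraLenstraLovasz1982, §1 (the bᵢ remain a basis of L)] [cite: Bremner2011, §4.2] -/
theorem lllStep_span_eq (δ : ℝ) (s : LLLState n V) :
    Submodule.span ℤ (Set.range (lllStep φ δ s).b) = Submodule.span ℤ (Set.range s.b) := by
  unfold lllStep
  by_cases hk : 0 < s.k ∧ s.k < n
  · have hne : (⟨s.k - 1, by omega⟩ : Fin n) ≠ ⟨s.k, hk.2⟩ := fun h => by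
      have := congrArg Fin.val h; simp only at this; omega
    rw [dif_pos hk]
    dsimp only
    by_cases ht : LovaszTestAt δ (⇑φ ∘ lllSizeReduce φ s.b ⟨s.k, hk.2⟩ ⟨s.k - 1, by omega⟩)
        ⟨s.k - 1, by omega⟩ ⟨s.k, hk.2⟩
    · rw [if_pos ht]
      dsimp only
      rw [span_range_lllSizeReduceBelow, span_range_lllSizeReduce φ _ hne]
    · rw [if_neg ht]
      dsimp only
      rw [(Equiv.swap _ _).surjective.range_comp, span_range_lllSizeReduce φ _ hne]
  · rw [dif_neg hk]
    split_ifs <;> rfl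

/-- Hence every iterate of the algorithm generates the same subgroup as the input family. [cite: LenstraLenstraLovasz1982, §1] -/
theorem iterate_lllStep_span_eq (δ : ℝ) (s : LLLState n V) (t : ℕ) :
    Submodule.span ℤ (Set.range ((lllStep φ δ)^[t] s).b) = Submodule.span ℤ (Set.range s.b) := by
  induction t with
  | zero => rfl
  | succ t ih => rw [iterate_succ_apply', lllStep_span_eq, ih]

/-- In particular the output of the LLL algorithm generates the same subgroup as its input. [cite: LenstraLenstraLovasz1982, §1] -/
theorem lllResult_span_eq (δ : ℝ) (b : Fin n → V) :
    Submodule.span ℤ (Set.range (lllResult φ δ b)) = Submodule.span ℤ (Set.range b) := by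
  classical
  unfold lllResult
  split_ifs with h
  · exact iterate_lllStep_span_eq φ δ (lllStart b) _
  · rfl

/-! ### Named facts: the loop invariant, termination, sizes -/

/-- **Loop invariant / correctness on termination** (LLL82 §1, the discussion of Fig. 1;
Bremner Lemma 4.13): at every state reached from the start state, `|μᵢⱼ| ≤ 1/2` for
`j < i < k` and `δ ‖b*ᵢ₋₁‖² ≤ ‖b*ᵢ + μᵢ,ᵢ₋₁ b*ᵢ₋₁‖²` for `1 ≤ i < k`; consequently, if an
iterate of the start state is halted (`n ≤ k`), the family it carries is LLL-reduced with
parameter `δ` in the sense of `Literature.Algebra.EuclideanLattices.IsLLLReduced` (applied to the measured family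
`φ ∘ b`). No independence hypothesis is needed (for a vanishing `b*ₗ` the coefficient `μₖₗ` is
the junk value `0` and `reduce(k, l)` does nothing). Stated for a fixed measuring map
`φ : V →+ E` (a family of facts, like `Literature.Computability.Complexity.PolyTimeComputable.comp`); LLL82 and Bremner
have `V = E = ℝⁿ`, `φ = id`, and the integer case is `φ = intVecToEuclidean m`.
[cite: LenstraLenstraLovasz1982, §1 Fig. 1 and Prop. 1.26] [cite: Bremner2011, Lemma 4.13] -/
def isLLLReduced_of_halted : Prop :=
  ∀ {n : ℕ} (δ : ℝ) (b : Fin n → V) (t : ℕ),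
    n ≤ ((lllStep φ δ)^[t] (lllStart b)).k →
      IsLLLReduced δ (⇑φ ∘ ((lllStep φ δ)^[t] (lllStart b)).b)

/-- **Termination bound** (LLL82, proof of Prop. 1.26, first half; Bremner Lemmas 4.14, 4.16,
4.18 and Thm. 4.19 with `α = δ`): let `b₀, …, bₙ₋₁ ∈ ℤᵐ` be linearly independent (over `ℝ`,
as vectors of `ℝᵐ`) with `‖bᵢ‖² ≤ B` for all `i`, and `1/4 < δ < 1`. With
`dᵢ = det (⟪bⱼ, bₗ⟫)_{j,l ≤ i} = ∏_{j ≤ i} ‖b*ⱼ‖² ∈ ℤ_{>0}` and `D = ∏_{i < n-1} dᵢ ≤ B^{n(n-1)/2}`,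
size reductions fix `D` and each exchange multiplies one `dₖ₋₁` by a factor `< δ`, so the
number `X` of exchanges satisfies `X ≤ (n(n-1)/2) · log B / log(1/δ)`, and the number of passes
before termination is at most `(n-1) + 2X`. Formally: the iterate of the start state at time
`(n - 1) + 2 ⌊(n(n-1)/2) · log B / log(1/δ)⌋₊` is halted. (LLL82 assumes `B ≥ 2` and `m = n`;
Bremner states the bound with `B` the maximum of the norms, i.e. `B^{n(n-1)}` for our
`B^{n(n-1)/2}`; the rectangular case `m ≥ n` is Cohen 1993, Algorithm 2.6.3.)
[cite: LenstraLenstraLovasz1982, Prop. 1.26 (proof)] [cite: Bremner2011, Thm. 4.19] [cite: Cohen1993, Algorithm 2.6.3 and pp. 134–135] -/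
def lll_halts_within : Prop :=
  ∀ {n m : ℕ} (δ B : ℝ) (b : Fin n → (Fin m → ℤ)),
    1 / 4 < δ → δ < 1 →
    LinearIndependent ℝ (⇑(intVecToEuclidean m) ∘ b) →
    (∀ i, ‖intVecToEuclidean m (b i)‖ ^ 2 ≤ B) →
      n ≤ ((lllStep (intVecToEuclidean m).toAddMonoidHom δ)^[
        (n - 1) + 2 * ⌊((n : ℝ) * (n - 1) / 2) * Real.log B / Real.log (1 / δ)⌋₊] (lllStart b)).k

/-- **Size of the vectors during the algorithm** (LLL82, proof of Prop. 1.26, second half;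
Bremner Thm. 4.23, equations (4.6)–(4.9)): under the hypotheses of `lll_halts_within` (integer
vectors, linearly independent, `‖bᵢ‖² ≤ B`, `1/4 < δ < 1`), at every state reached from the
start state every vector of the current family satisfies `‖bᵢ‖² ≤ n² (4B)ⁿ` (Bremner (4.6):
`|y_l| ≤ n^{1/2} B'` for `l ≠ k` and `|y_k| ≤ n (2B')ⁿ` with `B' = max |x_i| = B^{1/2}`); in
particular all entries are integers of binary length `O(n log B)`.
[cite: LenstraLenstraLovasz1982, Prop. 1.26 (proof)] [cite: Bremner2011, Thm. 4.23 (4.6)] -/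
def lll_norm_sq_le : Prop :=
  ∀ {n m : ℕ} (δ B : ℝ) (b : Fin n → (Fin m → ℤ)),
    1 / 4 < δ → δ < 1 →
    LinearIndependent ℝ (⇑(intVecToEuclidean m) ∘ b) →
    (∀ i, ‖intVecToEuclidean m (b i)‖ ^ 2 ≤ B) →
      ∀ (t : ℕ) (i : Fin n),
        ‖intVecToEuclidean m
            (((lllStep (intVecToEuclidean m).toAddMonoidHom δ)^[t] (lllStart b)).b i)‖ ^ 2 ≤
          (n : ℝ) ^ 2 * (4 * B) ^ n

end Algorithm

/-! ### The algorithm on integer basis matrices and its polynomial running time -/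

namespace LatticeInstance

/-- LLL82's basis reduction algorithm with `δ = 3/4` on a lattice instance: the rows of the
output matrix are `lllResult` of the rows of `I.basis`, measured in `ℝⁿ` through
`intVecToEuclidean`. This is the function whose polynomial-time computability is LLL82
Prop. 1.26 (`Literature.Algebra.EuclideanLattices.lll_polyTime`). [cite: LenstraLenstraLovasz1982, §1 Fig. 1 and Prop. 1.26] -/
def lllReduce (I : LatticeInstance) : LatticeInstance :=
  ⟨I.n, lllResult (intVecToEuclidean I.n).toAddMonoidHom (3 / 4) I.basis⟩

/-- The dimension is unchanged. [folklore] -/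
@[simp] theorem lllReduce_n (I : LatticeInstance) : I.lllReduce.n = I.n := rfl

/-- The output generates the same lattice as the input (from the proved `lllResult_span_eq`,
pushed forward along the embedding `ℤⁿ ↪ ℝⁿ`). [cite: LenstraLenstraLovasz1982, §1] -/
theorem lllReduce_lattice (I : LatticeInstance) : I.lllReduce.lattice = I.lattice := by
  have h := lllResult_span_eq (intVecToEuclidean I.n).toAddMonoidHom (3 / 4) I.basis
  have key : ∀ b : Fin I.n → (Fin I.n → ℤ),
      Submodule.span ℤ (Set.range (fun i => intVecToEuclidean I.n (b i))) =
        (Submodule.span ℤ (Set.range b)).map (intVecToEuclidean I.n) := by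
    intro b
    rw [Submodule.map_span, ← Set.range_comp]
    rfl
  show Submodule.span ℤ (Set.range fun i => intVecToEuclidean I.n (lllResult _ (3 / 4) I.basis i)) =
    Submodule.span ℤ (Set.range fun i => intVecToEuclidean I.n (I.basis i))
  rw [key, key, h]

end LatticeInstance

/-- **Polynomial running time of the LLL algorithm** (LLL82 Prop. 1.26 as printed: the
algorithm of Fig. 1 on a basis `b₁, …, bₙ ∈ ℤⁿ` with `|bᵢ|² ≤ B` terminates and takes
`O(n⁴ log B)` arithmetic operations on integers of binary length `O(n log B)`; Bremner
Thms. 4.22–4.23), in the machine form used by `Literature.Algebra.EuclideanLattices.lll_polyTime`: there is a function on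
lattice instances, computable in time polynomial in the length of the bit encoding
`LatticeInstance.encode` (arithmetic on `O(n log B)`-bit integers costs polynomially many bit
operations, and multi-stack machines execute them with polynomial overhead, Arora–Barak 2009,
§1.3), which on every *nonsingular* instance (the hypothesis of LLL82: the rows are a basis)
returns `LatticeInstance.lllReduce`, the output of LLL82's algorithm with `δ = 3/4`. Nothing is
asserted on singular inputs (as in `Literature.Algebra.EuclideanLattices.lll_polyTime`). The intended discharge is a
structured stack program (`Literature.Computability.Complexity.Com.mem_FP`) running `lllStep` for (at least) the
budget of `lll_halts_within` — halted states are fixed points, so any larger budget returns the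
same family — on registers of the size given by `lll_norm_sq_le`.
[cite: LenstraLenstraLovasz1982, Prop. 1.26] [cite: Bremner2011, Thms. 4.22–4.23] [cite: AroraBarak2009, §1.3] -/
def lllReduce_polyTime : Prop :=
  ∃ f : LatticeInstance → LatticeInstance,
    Literature.Computability.Complexity.PolyTimeComputable LatticeInstance.encode LatticeInstance.encode f ∧
      ∀ I : LatticeInstance, I.IsNonsingular → f I = I.lllReduce

end Literature.Algebra.EuclideanLattices
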